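import Literature.Barriers.MatrixMultiplication.IrreversibilityBarrier
import Literature.Computability.AlgebraicComplexity.RelativeExponentProofs
import Literature.Computability.AlgebraicComplexity.GroupAlgebraTensor
import Literature.Computability.AlgebraicComplexity.FlatteningRank
import HarnessLib

/-!
# CVZ 2021, Proposition 5 (`i(t) ≥ 1`) — proved

Topic `Literature/Barriers/MatrixMultiplication`; sibling of `IrreversibilityBarrier.lean`, whose
named fact `CVZ2021_prop5` (M. Christandl, P. Vrana, J. Zuiddam, *Barriers for fast matrix
multiplication from irreversibility*, Theory of Computing 17 (2021), art. 2 = arXiv:1812.06952,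
**arXiv v1/v2 numbering**, Prop. 5 on p. 5; page-checked with `lit read`) is DISCHARGED here:
`CVZ2021_prop5_holds : CVZ2021_prop5`.

## The printed statement and proof

Prop. 5: "For any tensor `t` holds that `i(t) ≥ 1`", where `i(t) = ω(⟨2⟩,t) · ω(t,⟨2⟩)` (Def. 4)
and `ω(t,s) = lim_n n⁻¹ min {m | t^{⊗m} ≥ s^{⊗n}}` (Def. 2). The printed proof is the line before
Prop. 5: "from the basic properties of the relative exponent [Prop. 3: `ω(t,t) = 1` and the triangle
inequality] follows directly `i(t) = ω(⟨2⟩,t) ω(t,⟨2⟩) ≥ ω(⟨2⟩,⟨2⟩) = 1`."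

## The proof here (for the tree's formalisation)

The tree formalises `ω(t,s)` as `⨅_{n ≥ 1} n⁻¹ f(n)`, `f(n) = restrictionCost t s n = sInf {m | …}`
(`RelativeExponent.lean`), and `CVZ2021_prop5` carries the finiteness hypothesis
`∃ m, t^{⊗m} ≥ ⟨2⟩` (see the module docstring of `IrreversibilityBarrier.lean`, "junk values"). We
unfold the printed one-liner into the elementary inequality it rests on:

* `f(n) := min {m | ⟨2⟩^{⊗m} ≥ t^{⊗n}}` is attained — every tensor `s` of finite format lies below a
  power of `⟨2⟩`: `s ≤ ⟨R(s)⟩` (`tensorRestrictsTo_unitTensor_of_tensorRank_le`) and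
  `⟨r⟩ ≤ ⟨2⟩^{⊗r}` (`unitTensor_pow_restrictsTo_unitTensor`, the indicator vectors `δ_i ∈ {0,1}^r`);
* `g(n') := min {m | t^{⊗m} ≥ ⟨2⟩^{⊗n'}}` is attained under the hypothesis `t^{⊗m₀} ≥ ⟨2⟩`:
  `t^{⊗(n' m₀)} ≥ (t^{⊗m₀})^{⊗n'} ≥ ⟨2⟩^{⊗n'}` (`tensorMonRestrictsTo_kroneckerPow_mul`,
  `TensorRestrictsTo.kroneckerPow`);
* composing (restriction is transitive and compatible with powers — this is the content of the
  triangle inequality of Prop. 3),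
  `(⟨2⟩^{⊗f(n)})^{⊗g(n')} ≥ (t^{⊗n})^{⊗g(n')} ≥ (t^{⊗g(n')})^{⊗n} ≥ (⟨2⟩^{⊗n'})^{⊗n}`;
* the flattening rank `ζ⁽¹⁾` is monotone under restriction and multiplicative under `⊗`
  (`flatteningRank_mono`, `flatteningRank_kroneckerPow`, `FlatteningRank.lean`) and
  `ζ⁽¹⁾(⟨2⟩) = 2` (`flatteningRank_unitTensor`) — this is the content of `ω(⟨2⟩,⟨2⟩) = 1`, i.e.
  `⟨2⟩^{⊗M} ≥ ⟨2⟩^{⊗N} ⇒ N ≤ M` — whence `2^{n n'} ≤ 2^{f(n) g(n')}`, `n n' ≤ f(n) g(n')`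
  (`mul_le_restrictionCost_mul`);
* so every product of terms of the two infima is `≥ 1`, hence so is the product of the infima
  (`one_le_ciInf_mul_ciInf`): `1 ≤ i(t)` (`one_le_irreversibility`).

Assumption 1 of CVZ (`t` not of the form `u ⊗ v ⊗ w`), carried by `CVZ2021_prop5`, is not needed
(it is implied by the finiteness hypothesis). Everything except the flattening-rank step holds over
a commutative semiring; the statement discharged is the one vendored, unchanged.

## References

* M. Christandl, P. Vrana, J. Zuiddam, ToC 17 (2021), art. 2 = arXiv:1812.06952, Def. 2, Prop. 3,
  Def. 4, Prop. 5 (p. 5). [ChristandlVranaZuiddam2021]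
-/

noncomputable section

open scoped BigOperators
open Module Submodule

namespace Literature.Barriers.MatrixMultiplication

open Literature.Computability.AlgebraicComplexity

universe u

/-! ## Powers of the unit tensor `⟨2⟩` -/

section UnitPow

variable {K : Type u} [CommSemiring K]
variable {ι κ μ : Type*}

/-- **`⟨n⟩^{⊗m}` is the diagonal tensor on `(Fin n)^m`**: entry `1` at `(x, x, x)`, `0` elsewhere
(`x y = z` coordinatewise iff as functions). [folklore] -/
theorem kroneckerPow_unitTensor_apply (n m : ℕ) (x y z : Fin m → Fin n) :
    kroneckerPow (unitTensor K n) m x y z = if x = y ∧ y = z then 1 else 0 := by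
  simp only [kroneckerPow_apply, unitTensor_apply]
  exact prod_ite_one_zero K _ _ (by rw [forall_and, funext_iff, funext_iff])

variable (K) in
/-- **`⟨2⟩^{⊗r} ≥ ⟨r⟩`**: relabelling the diagonal of `⟨2⟩^{⊗r}` along the (injective) indicator
vectors `i ↦ δ_i ∈ {0,1}^r` gives the diagonal `⟨r⟩` (CVZ §2.2: `ω(⟨2⟩, t) = log₂ R̃(t)` rests on
`⟨2⟩^{⊗m} ≅ ⟨2^m⟩ ≥ ⟨r⟩` for `r ≤ 2^m`; here the crude `r ≤ 2^r` suffices). [folklore] -/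
theorem unitTensor_pow_restrictsTo_unitTensor (r : ℕ) :
    TensorRestrictsTo (kroneckerPow (unitTensor K 2) r) (unitTensor K r) := by
  set e : Fin r → Fin r → Fin 2 := fun i l => if l = i then 1 else 0 with he
  have hinj : Function.Injective e := by
    intro i j h
    by_contra hij
    have h1 := congrFun h i
    simp [he, hij] at h1
  have key : unitTensor K r = fun i j k => kroneckerPow (unitTensor K 2) r (e i) (e j) (e k) := by
    funext i j k
    rw [kroneckerPow_unitTensor_apply, unitTensor_apply]
    exact if_congr (by rw [hinj.eq_iff, hinj.eq_iff]) rfl rfl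
  rw [key]
  exact tensorRestrictsTo_precomp _ _ _ _

/-- **Every tensor of finite format lies below a power of `⟨2⟩`**: `s ≤ ⟨R(s)⟩ ≤ ⟨2⟩^{⊗R(s)}`, so
the sets `{m | ⟨2⟩^{⊗m} ≥ s^{⊗n}}` defining `ω(⟨2⟩, s)` are nonempty (CVZ §2.2,
`ω(⟨2⟩,t) = log₂ R̃(t) < ∞`). [folklore] -/
theorem exists_unitTensor_pow_restrictsTo [Fintype ι] [Fintype κ] [Fintype μ] (s : ι → κ → μ → K) :
    ∃ m, TensorRestrictsTo (kroneckerPow (unitTensor K 2) m) s :=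
  ⟨tensorRank s, (unitTensor_pow_restrictsTo_unitTensor K _).trans
    (tensorRestrictsTo_unitTensor_of_tensorRank_le s le_rfl)⟩

/-- **Swapping iterated powers**: `(t^{⊗n})^{⊗N} ≥ (t^{⊗N})^{⊗n}` (transpose the index functions
`Fin n → Fin N → ι`; the entries agree by `Finset.prod_comm`). [folklore] -/
theorem tensorRestrictsTo_pow_pow_swap [Fintype ι] [Fintype κ] [Fintype μ] [DecidableEq ι]
    [DecidableEq κ] [DecidableEq μ] (t : ι → κ → μ → K) (n N : ℕ) :
    TensorRestrictsTo (kroneckerPow (kroneckerPow t n) N) (kroneckerPow (kroneckerPow t N) n) := by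
  have key : kroneckerPow (kroneckerPow t N) n = fun a b c =>
      kroneckerPow (kroneckerPow t n) N (fun j i => a i j) (fun j i => b i j) (fun j i => c i j) := by
    funext a b c
    simp only [kroneckerPow_apply]
    exact Finset.prod_comm
  rw [key]
  exact tensorRestrictsTo_precomp _ _ _ _

/-- Under one witness `t^{⊗m₀} ≥ ⟨2⟩`, every set `{m | t^{⊗m} ≥ ⟨2⟩^{⊗n}}` is nonempty
(`t^{⊗(n m₀)} ≥ (t^{⊗m₀})^{⊗n} ≥ ⟨2⟩^{⊗n}`), so `min {m | t^{⊗m} ≥ ⟨2⟩^{⊗n}}` is a witness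
(CVZ Def. 2; the finiteness hypothesis of `CVZ2021_prop5`). [cite: ChristandlVranaZuiddam2021, Def. 2] -/
theorem restrictionCost_unitTensor_mem [Fintype ι] [Fintype κ] [Fintype μ] {t : ι → κ → μ → K}
    (hQ : ∃ m, TensorRestrictsTo (kroneckerPow t m) (unitTensor K 2)) (n : ℕ) :
    TensorRestrictsTo (kroneckerPow t (restrictionCost t (unitTensor K 2) n))
      (kroneckerPow (unitTensor K 2) n) := by
  obtain ⟨m₀, hm₀⟩ := hQ
  have hne : {m | TensorRestrictsTo (kroneckerPow t m) (kroneckerPow (unitTensor K 2) n)}.Nonempty :=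
    ⟨n * m₀, (tensorMonRestrictsTo_kroneckerPow_mul t n m₀).tensorRestrictsTo.trans (hm₀.kroneckerPow n)⟩
  exact Nat.sInf_mem hne

/-- `min {m | ⟨2⟩^{⊗m} ≥ t^{⊗n}}` is a witness, for every tensor `t` of finite format (CVZ Def. 2
at `ω(⟨2⟩, t)`). [cite: ChristandlVranaZuiddam2021, Def. 2] -/
theorem unitTensor_restrictionCost_mem [Fintype ι] [Fintype κ] [Fintype μ] (t : ι → κ → μ → K)
    (n : ℕ) :
    TensorRestrictsTo (kroneckerPow (unitTensor K 2) (restrictionCost (unitTensor K 2) t n))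
      (kroneckerPow t n) :=
  Nat.sInf_mem (exists_unitTensor_pow_restrictsTo (kroneckerPow t n))

end UnitPow

/-! ## The flattening rank of `⟨n⟩` and the key inequality `n n' ≤ f(n) g(n')` -/

section Key

variable {K : Type u} [Field K]
variable {ι κ μ : Type*}

variable (K) in
/-- **`ζ⁽¹⁾(⟨n⟩) = n`**: the `n` slices of the diagonal are the distinct coordinate matrices
`E_{ii}`, linearly independent (Strassen's gauge points at unit tensors; CVZ 2023, Example 1.4).
[folklore] -/
theorem flatteningRank_unitTensor (n : ℕ) : flatteningRank (unitTensor K n) = n := by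
  have hli : LinearIndependent K (xSlices (unitTensor K n)) := by
    rw [Fintype.linearIndependent_iff]
    intro g hg i
    have h := congrFun hg (i, i)
    rw [Finset.sum_apply, Pi.zero_apply, Finset.sum_eq_single i] at h
    · simpa [xSlices_apply] using h
    · intro j _ hj
      simp [xSlices_apply, hj]
    · simp
  unfold flatteningRank
  rw [finrank_span_eq_card hli, Fintype.card_fin]

/-- **The inequality behind Prop. 5**: `n · n' ≤ f(n) · g(n')` for
`f(n) = min {m | ⟨2⟩^{⊗m} ≥ t^{⊗n}}`, `g(n') = min {m | t^{⊗m} ≥ ⟨2⟩^{⊗n'}}` (under the finiteness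
hypothesis `∃ m, t^{⊗m} ≥ ⟨2⟩`): composing the two witnesses,
`(⟨2⟩^{⊗f})^{⊗g} ≥ (t^{⊗n})^{⊗g} ≥ (t^{⊗g})^{⊗n} ≥ (⟨2⟩^{⊗n'})^{⊗n}` (Prop. 3, triangle inequality),
and comparing flattening ranks, `2^{n' n} ≤ 2^{f g}` (`ω(⟨2⟩,⟨2⟩) = 1`).
[cite: ChristandlVranaZuiddam2021, Prop. 3 and Prop. 5] -/
theorem mul_le_restrictionCost_mul [Fintype ι] [Fintype κ] [Fintype μ] (t : ι → κ → μ → K)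
    (hQ : ∃ m, TensorRestrictsTo (kroneckerPow t m) (unitTensor K 2)) (n n' : ℕ) :
    n * n' ≤ restrictionCost (unitTensor K 2) t n * restrictionCost t (unitTensor K 2) n' := by
  classical
  have h4 := ((unitTensor_restrictionCost_mem t n).kroneckerPow
    (restrictionCost t (unitTensor K 2) n')).trans
      ((tensorRestrictsTo_pow_pow_swap t n _).trans ((restrictionCost_unitTensor_mem hQ n').kroneckerPow n))
  have hle := flatteningRank_mono h4
  rw [flatteningRank_kroneckerPow, flatteningRank_kroneckerPow, flatteningRank_kroneckerPow,
    flatteningRank_kroneckerPow, flatteningRank_unitTensor, ← pow_mul, ← pow_mul] at hle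
  have h := (Nat.pow_le_pow_iff_right (by norm_num)).1 hle
  rwa [mul_comm n' n] at h

end Key

/-! ## Products of infima and the discharge -/

section Discharge

/-- If every product `x_n · y_{n'}` of terms of two sequences (`x ≥ 0`) is `≥ 1`, then so is the
product of their infima (`1/x_n ≤ inf y` for each `n`, then `1/inf y ≤ inf x`). [folklore] -/
theorem one_le_ciInf_mul_ciInf {x y : ℕ → ℝ} (hx : ∀ n, 0 ≤ x n) (h : ∀ n n', 1 ≤ x n * y n') :
    1 ≤ (⨅ n, x n) * ⨅ n, y n := by
  have hxpos : ∀ n, 0 < x n := fun n => (hx n).lt_of_ne fun h0 => by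
    have h1 := h n 0
    rw [← h0, zero_mul] at h1
    exact absurd h1 (by norm_num)
  have hy : ∀ n n', (x n)⁻¹ ≤ y n' := fun n n' =>
    calc (x n)⁻¹ = (x n)⁻¹ * 1 := (mul_one _).symm
      _ ≤ (x n)⁻¹ * (x n * y n') := mul_le_mul_of_nonneg_left (h n n') (inv_nonneg.2 (hx n))
      _ = y n' := by rw [← mul_assoc, inv_mul_cancel₀ (hxpos n).ne', one_mul]
  have hb : ∀ n, (x n)⁻¹ ≤ ⨅ n', y n' := fun n => le_ciInf (hy n)
  have hbpos : 0 < ⨅ n', y n' := (inv_pos.2 (hxpos 0)).trans_le (hb 0)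
  have ha : (⨅ n', y n')⁻¹ ≤ ⨅ n, x n :=
    le_ciInf fun n => (inv_le_comm₀ (hxpos n) hbpos).1 (hb n)
  calc (1 : ℝ) = (⨅ n', y n')⁻¹ * ⨅ n', y n' := (inv_mul_cancel₀ hbpos.ne').symm
    _ ≤ (⨅ n, x n) * ⨅ n', y n' := mul_le_mul_of_nonneg_right ha hbpos.le

/-- **CVZ 2021, Prop. 5, for the tree's `irreversibility`**: `1 ≤ i(t) = ω(⟨2⟩,t) · ω(t,⟨2⟩)` for
every 3-tensor `t` of finite format over a field with `t^{⊗m} ≥ ⟨2⟩` for some `m` (`Q̃(t) > 1`):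
termwise `1 ≤ (f(n)/n) · (g(n')/n')` by `mul_le_restrictionCost_mul`, then pass to the two infima.
[cite: ChristandlVranaZuiddam2021, Prop. 5] -/
theorem one_le_irreversibility {K : Type u} [Field K] {ι κ μ : Type*} [Fintype ι] [Fintype κ]
    [Fintype μ] (t : ι → κ → μ → K)
    (hQ : ∃ m, TensorRestrictsTo (kroneckerPow t m) (unitTensor K 2)) :
    1 ≤ irreversibility t := by
  unfold irreversibility relativeExponent
  refine one_le_ciInf_mul_ciInf (fun n => by positivity) fun n n' => ?_
  have h := mul_le_restrictionCost_mul t hQ (n + 1) (n' + 1)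
  rw [div_mul_div_comm, le_div_iff₀ (by positivity), one_mul]
  exact_mod_cast h

/-- **CVZ 2021, Proposition 5, discharged**: the named fact `CVZ2021_prop5` of
`IrreversibilityBarrier.lean` (`i(t) ≥ 1` for every `t` over a field, not of the form `u ⊗ v ⊗ w`,
with some power restricting to `⟨2⟩`) holds. [cite: ChristandlVranaZuiddam2021, Prop. 5] -/
theorem CVZ2021_prop5_holds : CVZ2021_prop5 :=
  fun _ _ _ _ _ _ _ _ t _ hQ => one_le_irreversibility t hQ

end Discharge

end Literature.Barriers.MatrixMultiplication

end
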